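import Literature.NumberTheory.Transcendental.PkappaTheta
import HarnessLib

/-!
# The theta model of `M_κ`: algebraic points have `ℚ̄`-rational projective coordinates

Topic: `Literature/NumberTheory/Transcendental`. Sequel to `PkappaTheta.lean` (theta functions
`GaGmE.Std.theta L κM J`, `J ∈ Option β × ((γ → Fin 3) × Option δ)`, of the group varieties
`M_κ = 𝔾ₘ^β × P_κ` of `SemistableQuotients.lean`), part of the theta model (plan item W2 of the
unit `provefact-Literature.NumberTheory.Transcendental.H-b596640137`).

PROVED here (`GaGmE.Std.exists_isAlgebraic_theta_div`): if `g₂, g₃ ∈ ℚ̄` and `w ∈ Lie M_κ,ℂ`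
exponentiates to an algebraic point of `M_κ` in the sense of `GaGmE.Std.Alg`
(`e^{y'_j} ∈ ℚ̄`; a representative `(z', t', s'')` with `(z'_b, t'_b)` a `ℚ̄`-point of `E♮` and
`s''_e = s_e - ∑_b κ_{eb} t'_b ∈ ℚ̄`), then the projective point `[Θ(w)]` is `ℚ̄`-rational: for a
suitable product of blocks `Θ_{(none,(i₀,none))}(w) = ∏_b P_{i₀ b}(z'_b) ≠ 0` all the ratios
`Θ_J(w) / ∏_b P_{i₀ b}(z'_b)` are algebraic. With `r_b = P_{M b}/P_{i₀ b}` and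
`q_b = Θ^{E♮}_{inr (M b)}(z'_b, t'_b)/P_{i₀ b}` (algebraic by
`PeriodPair.IsUnivExtAlgPoint.exists_isAlgebraic_univExtTheta_div`) the ratios are
`e^{y'_a} ∏_b r_b` and `e^{y'_a} ((s_e - ∑_b κ_{eb} t'_b) ∏_b r_b + ∑_b κ_{eb} q_b ∏_{b'≠b} r_{b'})`
(`thetaPsome_eq_mul_prod`) — so the representative `t'` of the push-out enters only through the
algebraic number `s''_e`, as it must. This is the input "`f_i(sv) = ϱ X_i(sγ)` with
`X_i(sγ) ∈ ℚ̄`" of Baker's method on `M_κ` (Baker–Wüstholz 2007, §6.8, p. 119).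

## References

* A. Baker, G. Wüstholz, *Logarithmic Forms and Diophantine Geometry*, CUP 2007, §6.8.
-/

noncomputable section

open Complex
open scoped PeriodPair

namespace Literature.NumberTheory.Transcendental

namespace GaGmE

namespace Std

variable {β γ δ : Type} [Fintype β] [Fintype γ] [Fintype δ] [DecidableEq γ]
variable (L : PeriodPair) (κM : δ → γ → Kbar)

omit [Fintype β] [Fintype γ] [Fintype δ] [DecidableEq γ] in
/-- Elements of `ℚ̄ ⊂ ℂ` are algebraic. [folklore] -/
theorem isAlgebraic_coe_Kbar (x : Kbar) : IsAlgebraic ℚ (x : ℂ) := mem_algebraicClosure_iff.mp x.2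

omit [Fintype β] [Fintype δ] in
/-- **Factorisation of the fibre sections through blockwise ratios.** If `d_b ≠ 0` and
`P_{M b}(z'_b) = r_b d_b`, `Z_{M b}(z'_b) = (t'_b r_b - q_b) d_b` for all `b`, then
`Θ^P_{(M, some e)}(w) = ((s_e - ∑_b κ_{eb} t'_b) ∏_b r_b + ∑_b κ_{eb} q_b ∏_{b'≠b} r_{b'}) · ∏_b d_b`.
[folklore] -/
theorem thetaPsome_eq_mul_prod (M : γ → Fin 3) (e : δ) (w : β ⊕ (γ ⊕ δ) → ℂ)
    (d r q t' : γ → ℂ) (hP : ∀ b, L.univExtP (M b) (w (iz b)) = r b * d b)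
    (hZ : ∀ b, L.univExtZ (M b) (w (iz b)) = (t' b * r b - q b) * d b) :
    thetaPsome L κM M e w =
      ((w (is e) - ∑ b, (κM e b : ℂ) * t' b) * ∏ b, r b +
        ∑ b, (κM e b : ℂ) * (q b * ∏ b' ∈ Finset.univ.erase b, r b')) * ∏ b, d b := by
  have hnone : thetaPnone (β := β) (δ := δ) L M w = (∏ b, r b) * ∏ b, d b := by
    unfold thetaPnone
    rw [← Finset.prod_mul_distrib]
    exact Finset.prod_congr rfl fun b _ => hP b
  have herase : ∀ b, ∏ b' ∈ Finset.univ.erase b, L.univExtP (M b') (w (iz b')) =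
      (∏ b' ∈ Finset.univ.erase b, r b') * ∏ b' ∈ Finset.univ.erase b, d b' := fun b => by
    rw [← Finset.prod_mul_distrib]
    exact Finset.prod_congr rfl fun b' _ => hP b'
  have key : ∀ b, (κM e b : ℂ) * (L.univExtZ (M b) (w (iz b)) *
      ∏ b' ∈ Finset.univ.erase b, L.univExtP (M b') (w (iz b'))) =
      (∏ b, d b) * (∏ b, r b) * ((κM e b : ℂ) * t' b) -
        (∏ b, d b) * ((κM e b : ℂ) * (q b * ∏ b' ∈ Finset.univ.erase b, r b')) := by
    intro b
    rw [hZ b, herase b, ← Finset.mul_prod_erase Finset.univ d (Finset.mem_univ b),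
      ← Finset.mul_prod_erase Finset.univ r (Finset.mem_univ b)]
    ring
  unfold thetaPsome
  rw [hnone, Finset.sum_congr rfl fun b _ => key b, Finset.sum_sub_distrib, ← Finset.mul_sum,
    ← Finset.mul_sum]
  ring

omit [Fintype β] [Fintype δ] in
/-- **At algebraic points of `M_κ` the projective point `[Θ(w)]` is `ℚ̄`-rational.** For
`w ∈ GaGmE.Std.Alg L κM` (and `g₂, g₃ ∈ ℚ̄`) there is a block index `i₀` with
`∏_b P_{i₀ b}(z'_b) ≠ 0` (`= Θ_{(none,(i₀,none))}(w)`) such that every ratio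
`Θ_J(w) / ∏_b P_{i₀ b}(z'_b)` is algebraic. [cite: BakerWustholz2007, §6.8 (p. 119: `f_i(sv) = ϱ X_i(sγ)`)] -/
theorem exists_isAlgebraic_theta_div {L : PeriodPair} (h₂ : IsAlgebraic ℚ L.g₂)
    (h₃ : IsAlgebraic ℚ L.g₃) (κM : δ → γ → Kbar) {w : β ⊕ (γ ⊕ δ) → ℂ} (hw : w ∈ Alg L κM) :
    ∃ i₀ : γ → Fin 3, thetaPnone (β := β) (δ := δ) L i₀ w ≠ 0 ∧
      ∀ J, IsAlgebraic ℚ (theta L κM J w / thetaPnone L i₀ w) := by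
  obtain ⟨hy, t', hzt, hs⟩ := hw
  have hb : ∀ b, ∃ i₀ : Fin 3, L.univExtP i₀ (w (iz b)) ≠ 0 ∧
      ∀ I, IsAlgebraic ℚ (L.univExtTheta I (w (iz b), t' b) / L.univExtP i₀ (w (iz b))) :=
    fun b => (hzt b).exists_isAlgebraic_univExtTheta_div h₂ h₃
  choose i₀ hi₀ halg using hb
  set d : γ → ℂ := fun b => L.univExtP (i₀ b) (w (iz b)) with hd_def
  have hd : ∀ b, d b ≠ 0 := hi₀
  have hD : thetaPnone (β := β) (δ := δ) L i₀ w = ∏ b, d b := rfl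
  have hD0 : ∏ b, d b ≠ 0 := Finset.prod_ne_zero_iff.mpr fun b _ => hd b
  refine ⟨i₀, by rwa [hD], ?_⟩
  -- blockwise ratios
  set r : (γ → Fin 3) → γ → ℂ := fun M b => L.univExtP (M b) (w (iz b)) / d b with hr_def
  set q : (γ → Fin 3) → γ → ℂ := fun M b =>
    L.univExtTheta (Sum.inr (M b)) (w (iz b), t' b) / d b with hq_def
  have hr : ∀ M b, IsAlgebraic ℚ (r M b) := fun M b => by
    have := halg b (Sum.inl (M b))
    simpa only [PeriodPair.univExtTheta_inl] using this
  have hq : ∀ M b, IsAlgebraic ℚ (q M b) := fun M b => halg b (Sum.inr (M b))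
  have hPr : ∀ M b, L.univExtP (M b) (w (iz b)) = r M b * d b := fun M b => by
    simp only [hr_def, div_mul_cancel₀ _ (hd b)]
  have hZq : ∀ M b, L.univExtZ (M b) (w (iz b)) = (t' b * r M b - q M b) * d b := fun M b => by
    have e : L.univExtTheta (Sum.inr (M b)) (w (iz b), t' b) =
        t' b * L.univExtP (M b) (w (iz b)) - L.univExtZ (M b) (w (iz b)) := rfl
    have hΘ : L.univExtTheta (Sum.inr (M b)) (w (iz b), t' b) = q M b * d b := by
      simp only [hq_def, div_mul_cancel₀ _ (hd b)]
    linear_combination e + t' b * hPr M b - hΘ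
  -- membership in `ℚ̄` is easier to propagate through sums and products
  have memK : ∀ {x : ℂ}, IsAlgebraic ℚ x → x ∈ algebraicClosure ℚ ℂ := fun hx =>
    mem_algebraicClosure_iff.mpr hx
  have algK : ∀ {x : ℂ}, x ∈ algebraicClosure ℚ ℂ → IsAlgebraic ℚ x := fun hx =>
    mem_algebraicClosure_iff.mp hx
  have hT : ∀ a, thetaT (γ := γ) (δ := δ) a w ∈ algebraicClosure ℚ ℂ := by
    rintro (_ | j)
    · exact one_mem _
    · exact memK (hy j)
  have hR : ∀ M, (∏ b, r M b) ∈ algebraicClosure ℚ ℂ := fun M =>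
    prod_mem fun b _ => memK (hr M b)
  intro J
  obtain ⟨a, M, _ | e⟩ := J
  · -- `Θ_{(a, (M, none))} / D = thetaT a · ∏ r`
    have e1 : theta L κM (a, (M, none)) w / thetaPnone L i₀ w = thetaT a w * ∏ b, r M b := by
      have hn : thetaPnone (β := β) (δ := δ) L M w = (∏ b, r M b) * ∏ b, d b := by
        unfold thetaPnone
        rw [← Finset.prod_mul_distrib]
        exact Finset.prod_congr rfl fun b _ => hPr M b
      simp only [theta, thetaP_none, hn, hD]
      field_simp
    rw [e1]
    exact algK (mul_mem (hT a) (hR M))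
  · -- `Θ_{(a, (M, some e))} / D = thetaT a · X`, `X` algebraic
    have hX : ((w (is e) - ∑ b, (κM e b : ℂ) * t' b) * ∏ b, r M b +
        ∑ b, (κM e b : ℂ) * (q M b * ∏ b' ∈ Finset.univ.erase b, r M b')) ∈
        algebraicClosure ℚ ℂ := by
      refine add_mem (mul_mem (memK (hs e)) (hR M)) (sum_mem fun b _ => ?_)
      exact mul_mem (isAlgebraic_coe_Kbar (κM e b) |> memK)
        (mul_mem (memK (hq M b)) (prod_mem fun b' _ => memK (hr M b')))
    have e1 : theta L κM (a, (M, some e)) w / thetaPnone L i₀ w =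
        thetaT a w * ((w (is e) - ∑ b, (κM e b : ℂ) * t' b) * ∏ b, r M b +
          ∑ b, (κM e b : ℂ) * (q M b * ∏ b' ∈ Finset.univ.erase b, r M b')) := by
      simp only [theta, thetaP_some, thetaPsome_eq_mul_prod L κM M e w d (r M) (q M) t'
        (hPr M) (hZq M), hD]
      field_simp
    rw [e1]
    exact algK (mul_mem (hT a) hX)

omit [Fintype β] [Fintype δ] in
/-- In particular `[Θ(w)]` has a representative with ALL coordinates algebraic: dividing by the
non-vanishing product of blocks. [folklore] -/
theorem exists_theta_div_mem_Kbar {L : PeriodPair} (h₂ : IsAlgebraic ℚ L.g₂)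
    (h₃ : IsAlgebraic ℚ L.g₃) (κM : δ → γ → Kbar) {w : β ⊕ (γ ⊕ δ) → ℂ} (hw : w ∈ Alg L κM) :
    ∃ J₀, theta L κM J₀ w ≠ 0 ∧ ∀ J, theta L κM J w / theta L κM J₀ w ∈ algebraicClosure ℚ ℂ := by
  obtain ⟨i₀, hi₀, h⟩ := exists_isAlgebraic_theta_div (β := β) h₂ h₃ κM hw
  refine ⟨(none, (i₀, none)), by simpa [theta] using hi₀, fun J => ?_⟩
  have : theta L κM (none, (i₀, none)) w = thetaPnone L i₀ w := by simp [theta]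
  rw [this]
  exact mem_algebraicClosure_iff.mpr (h J)

end Std

end GaGmE

end Literature.NumberTheory.Transcendental

end
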